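import Summits.ABC.IUTFork.Conditional.AbcOfSGenuineMWindow
import Summits.ABC.IUTFork.Cor312PilotIdelesMReadDeep
import HarnessLib

/-!
# Branch C certificate v11M-window, ODD-REVISION TWIN: the M-twin of the certificate of record with a DATUM-ONLY window predicate
# (`DeepOrdM`: at BAD members, in `ord_v(j_mod)`, `e_v`, and the genuine packet constants `d, a, b` of `K_{v̲}` — NO idele anywhere)

C scoreboard (INTAKE fold; C-lead ruling C-R23 (c) #4; abc-iut-C-cert-2 gen 2 = odd-revision writer / HYPS keeper). PROOF-ONLY companion (no
`def`, no new `Prop`, no instance, no notation; nothing re-typed) of abc-iut-C-cert-3's `Conditional/AbcOfSGenuineMWindow.lean`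
(`abc_of_SH_v11M_window`, p445989 ✓ — the M-TWIN of the certificate of record `abc_of_SH_v8K_window` p444039, C-R23 (a): explicit 3 =
[S_H, window] `hSHw` · [NUM, deep] `hNum` · [CONE] `hreg`; second read SOUND by abc-iut-C-cert-2, kernel probe `RQ7ProbeP445989`). There the
window is cut out by the EXPLICIT M-DEPTH LOCUS of abc-iut-w5-d166's `not_hSH_v10M_of_exists_deep` (p444095),
`DeepM(T) := ∃ u i x₀, p_u^{((i+2)·(d+a+b)(K_{v̲(x₀)})+1)} · ‖t_{q,x₀}‖^{(i+1)²−1} < 1`, written on the datum's OWN q-idele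
`t_{q,x₀} = tqM T.D p_u u _ (ideleDataOf T.D T.isVolumeInputOf) x₀`. THIS file removes the idele from the predicate — the M-line analogue of
abc-iut-C-cert-2's K-line `GenuineK.deep_iff_deepOrd` / `abc_of_SH_v9K_window` (p445646):

* `GenuineMShrink2.logRadiusA_add_logRadiusB_nonneg`, `GenuineMShrink2.depthConstants_nonneg` — `a + b ≥ 0` (`a ≥ 1/e`,
  `one_div_le_logRadiusA`; `b ≥ −1/e` since the floor in [IUTchIV] Prop. 1.2's `b` is `≥ 0`), hence `d + a + b ≥ 0` (`differentOrd_nonneg`):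
  the depth exponent `(i+2)(d+a+b)+1` is `≥ 1`, so NO GOOD member (`‖t_{q,x₀}‖ = 1`, abc-iut-w5-d033 `norm_tqM_eq_one_of_not_mem`) is ever deep.
* **`GenuineMShrink2.deepM_iff_deepOrdM`** — for EVERY idele datum `r` of `D`: `DeepM ⟺ DeepOrdM`, where
  `DeepOrdM(D) := ∃ u i x₀, v := placeModOfM D u x₀ ∈ V^bad_mod ∧ p_u^{((i+2)(d+a+b)+1)} · (p_u^{ord_v(j_mod)/(2l·e_v)})^{(i+1)²−1} < 1`
  — abc-iut-w5-d166's (H4)-M identity `norm_tqM_eq_rpow_ord_jMod` (p445977-lineage file `Cor312PilotIdelesMReadDeep` ✓: at a bad member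
  `‖t_{q,x}‖ = p^{ord_v(j_E)/(2l·e_v)}`, Dupuy–Hilado (3.4)) at bad members, the first bullet at good ones. `DeepOrdM` mentions NO idele, NO
  `ideleDataOf`, NO volume input: it is a predicate of `(E, F_mod, l, V^bad_mod)` and the member `x₀` (through the genuine completion `K_{v̲(x₀)}`).
* **`abc_of_SH_v11M_window_datum`** — p445989 VERBATIM except that the guard of `hSHw` / `hNum` is `DeepOrdM(T)`; explicit 3 = S_H(window) 1 ·
  NUM(deep) 1 · CONE 1 (H21 audit block). Proof: `abc_of_SH_v11M_window` BY NAME through `deepM_iff_deepOrdM` at `r := ideleDataOf T.D T.isVolumeInputOf`.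

WHY (C-R23 TARGET #2, the branch-B / T-c interface): a supplier of `hNum` at deep data, or of `hSHw` off them, must be able to READ the locus off
the datum — `ord_v(j_mod)`, `e_v`, `d, a, b` of `K_{v̲}` at a bad member — without constructing pilot ideles; this twin is that reading, kernel-checked
equivalent to the record's. HONEST FRAMING: this campaign LOCATES / CONDITIONALLY VERIFIES. Nothing here asserts that abc is proved or refuted, or
that [IUTchIII] Cor. 3.12 / Thm. 3.11 holds or fails at any datum, or takes a side on any author (Mochizuki / Scholze–Stix / Joshi /
Dupuy–Hilado); SHARP reading throughout; `hSHw` is not known to be satisfiable at every admissible datum off the locus; `hNum` is an assumption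
label for the disputed inequality at the datum, never asserted; «`ABC` follows from these hypotheses AS TYPED», nothing more; refuted-as-typed ≠
refuted-in-print; typed ≠ proved; instantiated ≠ endorsed. [claim: Mochizuki2012, status: disputed]
[cite: Mochizuki2012, IUTchIII Cor. 3.12 p. 173–174, Step (xi-d) p. 183, (xi-f) p. 184; IUTchIV Prop. 1.2 p. 10, Thm. 1.10 p. 22–31]
[cite: DupuyHilado2025, §3.3, §3.4, Thm. 3.10.1]
-/

noncomputable section

open Set Function NumberField IsDedekindDomain

namespace Summit.ABC.IUTFork.Conditional

open Thm311 Thm311.Real Cor312 Cor312Vol Cor312Prov Literature.IUT.LogThetaLattice Literature.IUT.LogVolume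
  Literature.IUT.HodgeTheaters Literature.IUT.LogVolume.ThetaData Literature.NumberTheory.NumberFields
open Literature.NumberTheory.DiophantineGeometry.GenEll Summit.ABC.ABC.Theorems

/-! ## §1. The depth exponent `(i+2)(d+a+b)+1` is at least `1` -/

/-- **`a + b ≥ 0`** for [IUTchIV] Prop. 1.2's exponents at a prime `p` and a ramification index `e ≥ 1`: `a ≥ 1/e` (`one_div_le_logRadiusA`)
and `b = ⌊log(pe/(p−1))/log p⌋ − 1/e ≥ −1/e` (the floor is `≥ 0` since `pe/(p−1) ≥ 1`). [cite: Mochizuki2012, IUTchIV Prop. 1.2 p. 10] -/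
theorem GenuineMShrink2.logRadiusA_add_logRadiusB_nonneg {p e : ℕ} (hp : p.Prime) (he : 1 ≤ e) :
    0 ≤ logRadiusA p e + logRadiusB p e := by
  have ha := one_div_le_logRadiusA hp he
  have hpR : (2 : ℝ) ≤ p := by exact_mod_cast hp.two_le
  have heR : (1 : ℝ) ≤ e := by exact_mod_cast he
  have hp1 : (0 : ℝ) < (p : ℝ) - 1 := by linarith
  have hlogp : 0 < Real.log p := Real.log_pos (by linarith)
  have hq : (1 : ℝ) ≤ (p : ℝ) * e / ((p : ℝ) - 1) := by
    rw [le_div_iff₀ hp1]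
    nlinarith
  have hfloor : (0 : ℝ) ≤ (⌊Real.log ((p : ℝ) * e / ((p : ℝ) - 1)) / Real.log p⌋ : ℝ) := by
    have h0 : (0 : ℤ) ≤ ⌊Real.log ((p : ℝ) * e / ((p : ℝ) - 1)) / Real.log p⌋ :=
      Int.floor_nonneg.mpr (div_nonneg (Real.log_nonneg hq) hlogp.le)
    exact_mod_cast h0
  unfold logRadiusB
  linarith

/-- **`d + a + b ≥ 0`** for the packet constants of a `p`-adic field (`d ≥ 0`, `differentOrd_nonneg`; `a + b ≥ 0`). Hence the explicit M-depth
exponent `(i+2)(d+a+b)+1 ≥ 1`. [cite: Mochizuki2012, IUTchIV Prop. 1.2 p. 10] -/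
theorem GenuineMShrink2.depthConstants_nonneg (p : ℕ) [hp : Fact p.Prime] (K₀ : Type) [NontriviallyNormedField K₀] [NormedAlgebra ℚ_[p] K₀]
    [IsUltrametricDist K₀] [ProperSpace K₀] :
    0 ≤ differentOrd p K₀ + logRadiusA p (absRamificationIdx p K₀) + logRadiusB p (absRamificationIdx p K₀) := by
  have he : 1 ≤ absRamificationIdx p K₀ := absRamificationIdx_pos p K₀
  have hd : 0 ≤ differentOrd p K₀ := differentOrd_nonneg p K₀
  have hab := GenuineMShrink2.logRadiusA_add_logRadiusB_nonneg (p := p) hp.out he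
  linarith

/-! ## §2. Per datum: the M-depth locus on the own q-idele ⟺ the datum-only locus at bad members -/

section PerDatum

variable {F K Fbar : Type} [Field F] [NumberField F] [Field K] [NumberField K] [Algebra F K] [Field Fbar]
  [Algebra F Fbar] [Algebra K Fbar] {E : WeierstrassCurve F} [E.IsElliptic] {l : ℕ} {Pb : BadPlacePredicates K}
  (D : InitialThetaData F K Fbar E l Pb)

/-- **`DeepM ⟺ DeepOrdM`** for EVERY idele datum `r` of `D`: the explicit M-depth locus of abc-iut-w5-d166's `not_hSH_v10M_of_exists_deep`
(p444095) written on the q-idele `tqM D p_u u _ r x₀` is equivalent to the same inequality with `‖t_{q,x₀}‖` replaced by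
`p_u^{ord_v(j_mod)/(2l·e_v)}` at a BAD member `v = placeModOfM D u x₀ ∈ V^bad_mod` (`norm_tqM_eq_rpow_ord_jMod`); good members are never deep
(`norm_tqM_eq_one_of_not_mem`, exponent `≥ 1` by `depthConstants_nonneg`). [cite: DupuyHilado2025, §3.3, §3.4]
[cite: Mochizuki2012, IUTchIV Prop. 1.2 p. 10] -/
theorem GenuineMShrink2.deepM_iff_deepOrdM (r : ThetaData.IdeleData D) :
    (∃ (u : FinitePlace ℚ) (i : Fin (thetaIndexOfInitial D).lstar) (x₀ : (thetaIndexOfInitial D).Fibre (Val.non u)),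
        ((ratChar u : ℕ) : ℝ) ^ ((((i : ℕ) : ℝ) + 2) *
        (differentOrd (ratChar u) (kOfM D (ratChar u) u (natCast_ratChar_mem u) x₀)
        + logRadiusA (ratChar u) (absRamificationIdx (ratChar u) (kOfM D (ratChar u) u (natCast_ratChar_mem u) x₀))
        + logRadiusB (ratChar u) (absRamificationIdx (ratChar u) (kOfM D (ratChar u) u (natCast_ratChar_mem u) x₀))) + 1) *
        ‖tqM D (ratChar u) u (natCast_ratChar_mem u) r x₀‖ ^ (((i : ℕ) + 1) ^ 2 - 1) < 1) ↔
    (∃ (u : FinitePlace ℚ) (i : Fin (thetaIndexOfInitial D).lstar) (x₀ : (thetaIndexOfInitial D).Fibre (Val.non u)),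
        placeModOfM D u x₀ ∈ (ThetaData.pilotData D).S ∧
        ((ratChar u : ℕ) : ℝ) ^ ((((i : ℕ) : ℝ) + 2) *
        (differentOrd (ratChar u) (kOfM D (ratChar u) u (natCast_ratChar_mem u) x₀)
        + logRadiusA (ratChar u) (absRamificationIdx (ratChar u) (kOfM D (ratChar u) u (natCast_ratChar_mem u) x₀))
        + logRadiusB (ratChar u) (absRamificationIdx (ratChar u) (kOfM D (ratChar u) u (natCast_ratChar_mem u) x₀))) + 1) *
        (((ratChar u : ℕ) : ℝ) ^ ((ord (fieldOfModuli E) (placeModOfM D u x₀) (ThetaData.jMod E) : ℝ) /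
          (2 * l * ramIdx (fieldOfModuli E) (placeModOfM D u x₀)))) ^ (((i : ℕ) + 1) ^ 2 - 1) < 1) := by
  constructor
  · rintro ⟨u, i, x₀, hlt⟩
    by_cases hx : placeModOfM D u x₀ ∈ (ThetaData.pilotData D).S
    · refine ⟨u, i, x₀, hx, ?_⟩
      rwa [norm_tqM_eq_rpow_ord_jMod D (ratChar u) u (natCast_ratChar_mem u) r x₀ hx] at hlt
    · -- at a good member the q-idele is a unit and the exponent is `≥ 1`: the inequality is impossible
      exfalso
      rw [norm_tqM_eq_one_of_not_mem D (ratChar u) u (natCast_ratChar_mem u) r x₀ hx, one_pow, mul_one] at hlt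
      have hp1 : (1 : ℝ) ≤ ((ratChar u : ℕ) : ℝ) := by exact_mod_cast (fact_ratChar_prime u).out.one_lt.le
      have hdab := GenuineMShrink2.depthConstants_nonneg (ratChar u) (kOfM D (ratChar u) u (natCast_ratChar_mem u) x₀)
      have hi : (0 : ℝ) ≤ ((i : ℕ) : ℝ) + 2 := by positivity
      have hA : 0 ≤ (((i : ℕ) : ℝ) + 2) *
          (differentOrd (ratChar u) (kOfM D (ratChar u) u (natCast_ratChar_mem u) x₀)
          + logRadiusA (ratChar u) (absRamificationIdx (ratChar u) (kOfM D (ratChar u) u (natCast_ratChar_mem u) x₀))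
          + logRadiusB (ratChar u) (absRamificationIdx (ratChar u) (kOfM D (ratChar u) u (natCast_ratChar_mem u) x₀))) + 1 := by
        nlinarith [mul_nonneg hi hdab]
      exact absurd hlt (not_lt.mpr (Real.one_le_rpow hp1 hA))
  · rintro ⟨u, i, x₀, hx, hlt⟩
    refine ⟨u, i, x₀, ?_⟩
    rwa [norm_tqM_eq_rpow_ord_jMod D (ratChar u) u (natCast_ratChar_mem u) r x₀ hx]

end PerDatum

/-! ## §3. The apex with the datum-only window: `abc_of_SH_v11M_window_datum` -/

/-- **`abc_of_SH_v11M_window_datum`** — abc-iut-C-cert-3's `abc_of_SH_v11M_window` (p445989, the M-twin of the certificate of record) with the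
DATUM-ONLY window predicate `DeepOrdM` (at bad members, in `ord_v(j_mod)`, `e_v` and the genuine packet constants of `K_{v̲}` — no idele, no
`ideleDataOf`). Explicit 3 = S_H(window) 1 · NUM(deep) 1 · CONE 1, as p445989. Proof: `abc_of_SH_v11M_window` BY NAME through
`GenuineMShrink2.deepM_iff_deepOrdM` at the datum's own idele data. «`ABC` follows from these hypotheses as typed» — no side taken on [IUTchIII]
Cor. 3.12; typed ≠ proved; instantiated ≠ endorsed. [claim: Mochizuki2012, status: disputed] -/
theorem abc_of_SH_v11M_window_datum
    -- DATA, per datum: the context binders of the summand-route M-level sharp setting (logs FIXED: analytic), the column data, qK (ρ is PINNED to the q-region)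
    (M : ∀ (P : NFPoint) (l : ℕ) (T : Cor22.ThetaVolumeDatumAt P l), Type) [∀ P l T, Field (M P l T)] [∀ P l T, NumberField (M P l T)]
    (archPk : ∀ (P : NFPoint) (l : ℕ) (T : Cor22.ThetaVolumeDatumAt P l), letI := T.instFieldF; letI := T.instNumberFieldF; letI := T.instAlgebraF; letI := T.instFieldK;
        letI := T.instNumberFieldK; letI := T.instAlgebraK; letI := T.instFieldFbar; letI := T.instAlgebraFbar;
        letI := T.instAlgebraKFbar; letI := T.instIsElliptic;
      ∀ (j : (thetaIndexOfInitial T.D).Label) (vQ : (thetaIndexOfInitial T.D).VQ), Set ((logShellsOfInitialDH T.D (analyticLogvVal T.K)).Packet j vQ))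
    (archSub : ∀ (P : NFPoint) (l : ℕ) (T : Cor22.ThetaVolumeDatumAt P l), letI := T.instFieldF; letI := T.instNumberFieldF; letI := T.instAlgebraF; letI := T.instFieldK;
        letI := T.instNumberFieldK; letI := T.instAlgebraK; letI := T.instFieldFbar; letI := T.instAlgebraFbar;
        letI := T.instAlgebraKFbar; letI := T.instIsElliptic;
      ∀ (j : (thetaIndexOfInitial T.D).Label) (v : (thetaIndexOfInitial T.D).V), Set ((logShellsOfInitialDH T.D (analyticLogvVal T.K)).Packet j ((thetaIndexOfInitial T.D).over v)))
    (Ψ : ∀ (P : NFPoint) (l : ℕ) (T : Cor22.ThetaVolumeDatumAt P l), letI := T.instFieldF; letI := T.instNumberFieldF; letI := T.instAlgebraF; letI := T.instFieldK;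
        letI := T.instNumberFieldK; letI := T.instAlgebraK; letI := T.instFieldFbar; letI := T.instAlgebraFbar;
        letI := T.instAlgebraKFbar; letI := T.instIsElliptic;
      ℤ → ∀ v : (thetaIndexOfInitial T.D).V, v ∈ (thetaIndexOfInitial T.D).Vbad → Set ((logShellsOfInitialDH T.D (analyticLogvVal T.K)).StarPacket v))
    (act : ∀ (P : NFPoint) (l : ℕ) (T : Cor22.ThetaVolumeDatumAt P l), letI := T.instFieldF; letI := T.instNumberFieldF; letI := T.instAlgebraF; letI := T.instFieldK;
        letI := T.instNumberFieldK; letI := T.instAlgebraK; letI := T.instFieldFbar; letI := T.instAlgebraFbar;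
        letI := T.instAlgebraKFbar; letI := T.instIsElliptic;
      ℤ → ∀ v : (thetaIndexOfInitial T.D).V, v ∈ (thetaIndexOfInitial T.D).Vbad → (logShellsOfInitialDH T.D (analyticLogvVal T.K)).StarPacket v → Module.End ℚ ((logShellsOfInitialDH T.D (analyticLogvVal T.K)).StarPacket v))
    (Mmod : ∀ (P : NFPoint) (l : ℕ) (T : Cor22.ThetaVolumeDatumAt P l), letI := T.instFieldF; letI := T.instNumberFieldF; letI := T.instAlgebraF; letI := T.instFieldK;
        letI := T.instNumberFieldK; letI := T.instAlgebraK; letI := T.instFieldFbar; letI := T.instAlgebraFbar;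
        letI := T.instAlgebraKFbar; letI := T.instIsElliptic;
      ℤ → ∀ j : (thetaIndexOfInitial T.D).LabelStar, Set ((logShellsOfInitialDH T.D (analyticLogvVal T.K)).GlobalPacket j.1))
    (region : ∀ (P : NFPoint) (l : ℕ) (T : Cor22.ThetaVolumeDatumAt P l), letI := T.instFieldF; letI := T.instNumberFieldF; letI := T.instAlgebraF; letI := T.instFieldK;
        letI := T.instNumberFieldK; letI := T.instAlgebraK; letI := T.instFieldFbar; letI := T.instAlgebraFbar;
        letI := T.instAlgebraKFbar; letI := T.instIsElliptic;
      ℤ → ∀ j : (thetaIndexOfInitial T.D).LabelStar, FinDivisor (M P l T) → ∀ vQ : (thetaIndexOfInitial T.D).VQ, Set ((logShellsOfInitialDH T.D (analyticLogvVal T.K)).Packet j.1 vQ))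
    (frobAdm : ∀ (P : NFPoint) (l : ℕ) (T : Cor22.ThetaVolumeDatumAt P l), letI := T.instFieldF; letI := T.instNumberFieldF; letI := T.instAlgebraF; letI := T.instFieldK;
        letI := T.instNumberFieldK; letI := T.instAlgebraK; letI := T.instFieldFbar; letI := T.instAlgebraFbar;
        letI := T.instAlgebraKFbar; letI := T.instIsElliptic;
      ℤ → ℤ → ∀ (j : (thetaIndexOfInitial T.D).Label) (vQ : (thetaIndexOfInitial T.D).VQ), Set ((logShellsOfInitialDH T.D (analyticLogvVal T.K)).Packet j vQ) → Prop)
    (frobLogvol : ∀ (P : NFPoint) (l : ℕ) (T : Cor22.ThetaVolumeDatumAt P l), letI := T.instFieldF; letI := T.instNumberFieldF; letI := T.instAlgebraF; letI := T.instFieldK;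
        letI := T.instNumberFieldK; letI := T.instAlgebraK; letI := T.instFieldFbar; letI := T.instAlgebraFbar;
        letI := T.instAlgebraKFbar; letI := T.instIsElliptic;
      ℤ → ℤ → ∀ (j : (thetaIndexOfInitial T.D).Label) (vQ : (thetaIndexOfInitial T.D).VQ), Set ((logShellsOfInitialDH T.D (analyticLogvVal T.K)).Packet j vQ) → ℝ)
    (frobΨ : ∀ (P : NFPoint) (l : ℕ) (T : Cor22.ThetaVolumeDatumAt P l), letI := T.instFieldF; letI := T.instNumberFieldF; letI := T.instAlgebraF; letI := T.instFieldK;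
        letI := T.instNumberFieldK; letI := T.instAlgebraK; letI := T.instFieldFbar; letI := T.instAlgebraFbar;
        letI := T.instAlgebraKFbar; letI := T.instIsElliptic;
      ℤ → ℤ → ∀ v : (thetaIndexOfInitial T.D).V, v ∈ (thetaIndexOfInitial T.D).Vbad → Set ((logShellsOfInitialDH T.D (analyticLogvVal T.K)).StarPacket v))
    (frobMmod : ∀ (P : NFPoint) (l : ℕ) (T : Cor22.ThetaVolumeDatumAt P l), letI := T.instFieldF; letI := T.instNumberFieldF; letI := T.instAlgebraF; letI := T.instFieldK;
        letI := T.instNumberFieldK; letI := T.instAlgebraK; letI := T.instFieldFbar; letI := T.instAlgebraFbar;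
        letI := T.instAlgebraKFbar; letI := T.instIsElliptic;
      ℤ → ℤ → ∀ j : (thetaIndexOfInitial T.D).LabelStar, Set ((logShellsOfInitialDH T.D (analyticLogvVal T.K)).GlobalPacket j.1))
    (unitImage : ∀ (P : NFPoint) (l : ℕ) (T : Cor22.ThetaVolumeDatumAt P l), letI := T.instFieldF; letI := T.instNumberFieldF; letI := T.instAlgebraF; letI := T.instFieldK;
        letI := T.instNumberFieldK; letI := T.instAlgebraK; letI := T.instFieldFbar; letI := T.instAlgebraFbar;
        letI := T.instAlgebraKFbar; letI := T.instIsElliptic;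
      ℤ → ℤ → ℕ → ∀ (j : (thetaIndexOfInitial T.D).Label) (vQ : (thetaIndexOfInitial T.D).VQ), Set ((logShellsOfInitialDH T.D (analyticLogvVal T.K)).Packet j vQ))
    (ballImage : ∀ (P : NFPoint) (l : ℕ) (T : Cor22.ThetaVolumeDatumAt P l), letI := T.instFieldF; letI := T.instNumberFieldF; letI := T.instAlgebraF; letI := T.instFieldK;
        letI := T.instNumberFieldK; letI := T.instAlgebraK; letI := T.instFieldFbar; letI := T.instAlgebraFbar;
        letI := T.instAlgebraKFbar; letI := T.instIsElliptic;
      ℤ → ℤ → ∀ (j : (thetaIndexOfInitial T.D).Label) (vQ : (thetaIndexOfInitial T.D).VQ), Set ((logShellsOfInitialDH T.D (analyticLogvVal T.K)).Packet j vQ))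
    (thetaDiv : ∀ (P : NFPoint) (l : ℕ) (T : Cor22.ThetaVolumeDatumAt P l), letI := T.instFieldF; letI := T.instNumberFieldF; letI := T.instAlgebraF; letI := T.instFieldK;
        letI := T.instNumberFieldK; letI := T.instAlgebraK; letI := T.instFieldFbar; letI := T.instAlgebraFbar;
        letI := T.instAlgebraKFbar; letI := T.instIsElliptic;
      ℤ → ℤ → LgpDivisor (M P l T) (thetaIndexOfInitial T.D).lstar)
    (n : ∀ (P : NFPoint) (l : ℕ) (T : Cor22.ThetaVolumeDatumAt P l), ℤ)
    {HT : ∀ (P : NFPoint) (l : ℕ) (T : Cor22.ThetaVolumeDatumAt P l), Type} {LogLink : ∀ (P : NFPoint) (l : ℕ) (T : Cor22.ThetaVolumeDatumAt P l), HT P l T → HT P l T → Type}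
    {IsFull : ∀ (P : NFPoint) (l : ℕ) (T : Cor22.ThetaVolumeDatumAt P l), ∀ {s t : HT P l T}, LogLink P l T s t → Prop}
    (lat : ∀ (P : NFPoint) (l : ℕ) (T : Cor22.ThetaVolumeDatumAt P l), LGPGaussianLogThetaLattice (LogLink P l T) (IsFull P l T))
    {Frd : ∀ (P : NFPoint) (l : ℕ) (T : Cor22.ThetaVolumeDatumAt P l), Type} {IsoF : ∀ (P : NFPoint) (l : ℕ) (T : Cor22.ThetaVolumeDatumAt P l), Frd P l T → Frd P l T → Type} {Ob : ∀ (P : NFPoint) (l : ℕ) (T : Cor22.ThetaVolumeDatumAt P l), Frd P l T → Type}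
    {realify : ∀ (P : NFPoint) (l : ℕ) (T : Cor22.ThetaVolumeDatumAt P l), Frd P l T → Frd P l T} {Strip : ∀ (P : NFPoint) (l : ℕ) (T : Cor22.ThetaVolumeDatumAt P l), Type} {IsoS : ∀ (P : NFPoint) (l : ℕ) (T : Cor22.ThetaVolumeDatumAt P l), Strip P l T → Strip P l T → Type}
    {Mv : ∀ (P : NFPoint) (l : ℕ) (T : Cor22.ThetaVolumeDatumAt P l), letI := T.instFieldF; letI := T.instNumberFieldF; letI := T.instAlgebraF; letI := T.instFieldK;
        letI := T.instNumberFieldK; letI := T.instAlgebraK; letI := T.instFieldFbar; letI := T.instAlgebraFbar;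
        letI := T.instAlgebraKFbar; letI := T.instIsElliptic;
      ∀ v : (thetaIndexOfInitial T.D).V, v ∈ (thetaIndexOfInitial T.D).Vbad → Type}
    [∀ P l T v h, Monoid (Mv P l T v h)]
    (sig : ∀ (P : NFPoint) (l : ℕ) (T : Cor22.ThetaVolumeDatumAt P l), letI := T.instFieldF; letI := T.instNumberFieldF; letI := T.instAlgebraF; letI := T.instFieldK;
        letI := T.instNumberFieldK; letI := T.instAlgebraK; letI := T.instFieldFbar; letI := T.instAlgebraFbar;
        letI := T.instAlgebraKFbar; letI := T.instIsElliptic;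
      GlobalLGPFrobenioidSignature (thetaIndexOfInitial T.D).lstar (thetaIndexOfInitial T.D).V (· ∈ (thetaIndexOfInitial T.D).Vbad) (Frd P l T) (IsoF P l T) (Ob P l T) (realify P l T)
        (Strip P l T) (IsoS P l T) (Mv P l T))
    (split : ∀ (P : NFPoint) (l : ℕ) (T : Cor22.ThetaVolumeDatumAt P l), SplittingMonoids (Mv P l T))
    {ObΔ : ∀ (P : NFPoint) (l : ℕ) (T : Cor22.ThetaVolumeDatumAt P l), Type}
    {N : ∀ (P : NFPoint) (l : ℕ) (T : Cor22.ThetaVolumeDatumAt P l), letI := T.instFieldF; letI := T.instNumberFieldF; letI := T.instAlgebraF; letI := T.instFieldK;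
        letI := T.instNumberFieldK; letI := T.instAlgebraK; letI := T.instFieldFbar; letI := T.instAlgebraFbar;
        letI := T.instAlgebraKFbar; letI := T.instIsElliptic;
      ∀ v : (thetaIndexOfInitial T.D).V, v ∈ (thetaIndexOfInitial T.D).Vbad → Type}
    [∀ P l T v h, Monoid (N P l T v h)] (qData : ∀ (P : NFPoint) (l : ℕ) (T : Cor22.ThetaVolumeDatumAt P l), QPilotData (ObΔ P l T) (N P l T))
    (qK : ∀ (P : NFPoint) (l : ℕ) (T : Cor22.ThetaVolumeDatumAt P l), letI := T.instFieldF; letI := T.instNumberFieldF; letI := T.instAlgebraF; letI := T.instFieldK;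
        letI := T.instNumberFieldK; letI := T.instAlgebraK; letI := T.instFieldFbar; letI := T.instAlgebraFbar;
        letI := T.instAlgebraKFbar; letI := T.instIsElliptic;
      ∀ v : (thetaIndexOfInitial T.D).V, v ∈ (thetaIndexOfInitial T.D).Vbad → Set ((logShellsOfInitialDH T.D (analyticLogvVal T.K)).StarPacket v))
    -- [S_H, WINDOW] v10M's hull-level clause (pinned reading, own ideles), ONLY at admissible data OFF the DATUM-ONLY M-depth locus `DeepOrdM`
    (hSHw : ∀ (P : NFPoint), P ∈ UP → ∀ (l : ℕ), l.Prime → 5 ≤ l →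
      Cor22.AdmitsCore P → Cor22.CondP2 P l → Cor22.CondP5 P l → Cor22.CondP6 P l →
      ∀ (T : Cor22.ThetaVolumeDatumAt P l), letI := T.instFieldF; letI := T.instNumberFieldF; letI := T.instAlgebraF; letI := T.instFieldK;
        letI := T.instNumberFieldK; letI := T.instAlgebraK; letI := T.instFieldFbar; letI := T.instAlgebraFbar;
        letI := T.instAlgebraKFbar; letI := T.instIsElliptic;
      (¬ ∃ (u : FinitePlace ℚ) (i : Fin (thetaIndexOfInitial T.D).lstar) (x₀ : (thetaIndexOfInitial T.D).Fibre (Val.non u)),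
        placeModOfM T.D u x₀ ∈ (ThetaData.pilotData T.D).S ∧
        ((ratChar u : ℕ) : ℝ) ^ ((((i : ℕ) : ℝ) + 2) *
        (differentOrd (ratChar u) (kOfM T.D (ratChar u) u (natCast_ratChar_mem u) x₀)
        + logRadiusA (ratChar u) (absRamificationIdx (ratChar u) (kOfM T.D (ratChar u) u (natCast_ratChar_mem u) x₀))
        + logRadiusB (ratChar u) (absRamificationIdx (ratChar u) (kOfM T.D (ratChar u) u (natCast_ratChar_mem u) x₀))) + 1) *
        (((ratChar u : ℕ) : ℝ) ^ ((ord (fieldOfModuli T.E) (placeModOfM T.D u x₀) (ThetaData.jMod T.E) : ℝ) /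
          (2 * l * ramIdx (fieldOfModuli T.E) (placeModOfM T.D u x₀)))) ^ (((i : ℕ) + 1) ^ 2 - 1) < 1) →
      Cor312Vol.PilotKummerCompatHull
        (LatticeSituation.ofShells (logShellsOfInitialDH T.D (analyticLogvVal T.K)) (M P l T) (archPk P l T) (archSub P l T)
          (summandPiecesPrM T.D (logvAnalyticVal_analyticLogvVal (K := T.K))).Adm
          (summandPiecesPrM T.D (logvAnalyticVal_analyticLogvVal (K := T.K))).logvol (Ψ P l T) (act P l T) (Mmod P l T)
          (region P l T) (frobAdm P l T) (frobLogvol P l T) (frobΨ P l T) (frobMmod P l T) (unitImage P l T) (ballImage P l T)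
          (thetaDiv P l T))
        (settingPrVolSharpM T.D (logvAnalyticVal_analyticLogvVal (K := T.K)) (tOfIdeleData T.D (ideleDataOf T.D T.isVolumeInputOf))
          (fun u x => tqM T.D (ratChar u) u (natCast_ratChar_mem u) (ideleDataOf T.D T.isVolumeInputOf) x)
          (M P l T) (archPk P l T) (archSub P l T) (Ψ P l T) (act P l T)
          (Mmod P l T) (region P l T) (n P l T) (lat P l T) (sig P l T) (split P l T) (qData P l T)
          (fun u x => tqM_ne_zero T.D (ratChar u) u (natCast_ratChar_mem u) (ideleDataOf T.D T.isVolumeInputOf) x)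
          (GenuineM.finite_ratPlaces_under_S T.D).toFinset
          (fun u x hu => norm_tqM_eq_one_of_not_mem T.D (ratChar u) u (natCast_ratChar_mem u) (ideleDataOf T.D T.isVolumeInputOf) x
            fun hx => hu ((Set.Finite.mem_toFinset _).mpr ⟨x, hx⟩))) 
        (fun _ => Cor312.Setting.qRegion
        (settingPrVolSharpM T.D (logvAnalyticVal_analyticLogvVal (K := T.K)) (tOfIdeleData T.D (ideleDataOf T.D T.isVolumeInputOf))
          (fun u x => tqM T.D (ratChar u) u (natCast_ratChar_mem u) (ideleDataOf T.D T.isVolumeInputOf) x)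
          (M P l T) (archPk P l T) (archSub P l T) (Ψ P l T) (act P l T)
          (Mmod P l T) (region P l T) (n P l T) (lat P l T) (sig P l T) (split P l T) (qData P l T)
          (fun u x => tqM_ne_zero T.D (ratChar u) u (natCast_ratChar_mem u) (ideleDataOf T.D T.isVolumeInputOf) x)
          (GenuineM.finite_ratPlaces_under_S T.D).toFinset
          (fun u x hu => norm_tqM_eq_one_of_not_mem T.D (ratChar u) u (natCast_ratChar_mem u) (ideleDataOf T.D T.isVolumeInputOf) x
            fun hx => hu ((Set.Finite.mem_toFinset _).mpr ⟨x, hx⟩)))) (qK P l T))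
    -- [NUM, DEEP] the NUMBER-level Corollary 3.12 of the datum, ONLY at admissible data ON the datum-only M-depth locus `DeepOrdM`
    (hNum : ∀ (P : NFPoint), P ∈ UP → ∀ (l : ℕ), l.Prime → 5 ≤ l →
      Cor22.AdmitsCore P → Cor22.CondP2 P l → Cor22.CondP5 P l → Cor22.CondP6 P l →
      ∀ (T : Cor22.ThetaVolumeDatumAt P l), letI := T.instFieldF; letI := T.instNumberFieldF; letI := T.instAlgebraF; letI := T.instFieldK;
        letI := T.instNumberFieldK; letI := T.instAlgebraK; letI := T.instFieldFbar; letI := T.instAlgebraFbar;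
        letI := T.instAlgebraKFbar; letI := T.instIsElliptic;
      (∃ (u : FinitePlace ℚ) (i : Fin (thetaIndexOfInitial T.D).lstar) (x₀ : (thetaIndexOfInitial T.D).Fibre (Val.non u)),
        placeModOfM T.D u x₀ ∈ (ThetaData.pilotData T.D).S ∧
        ((ratChar u : ℕ) : ℝ) ^ ((((i : ℕ) : ℝ) + 2) *
        (differentOrd (ratChar u) (kOfM T.D (ratChar u) u (natCast_ratChar_mem u) x₀)
        + logRadiusA (ratChar u) (absRamificationIdx (ratChar u) (kOfM T.D (ratChar u) u (natCast_ratChar_mem u) x₀))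
        + logRadiusB (ratChar u) (absRamificationIdx (ratChar u) (kOfM T.D (ratChar u) u (natCast_ratChar_mem u) x₀))) + 1) *
        (((ratChar u : ℕ) : ℝ) ^ ((ord (fieldOfModuli T.E) (placeModOfM T.D u x₀) (ThetaData.jMod T.E) : ℝ) /
          (2 * l * ramIdx (fieldOfModuli T.E) (placeModOfM T.D u x₀)))) ^ (((i : ℕ) + 1) ^ 2 - 1) < 1) → T.Cor312Of)
    -- [CONE] c312-8 p428563's `hreg`, verbatim · [READ]/[ORBIT]/[PIN]/[PROV]/[BRIDGE]/[SIDE]/[FACT] none (theorems at the M setting)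
    (hreg : ∀ P : NFPoint, P ∈ UP → ∀ l : ℕ, l.Prime → 5 ≤ l →
      Cor22.AdmitsCore P → Cor22.CondP2 P l → Cor22.CondP5 P l → Cor22.CondP6 P l →
      ∀ T : Cor22.ThetaVolumeDatumAt P l,
        (letI := T.instFieldF; letI := T.instNumberFieldF; letI := T.instAlgebraF; letI := T.instFieldK
         letI := T.instNumberFieldK; letI := T.instAlgebraK; letI := T.instFieldFbar; letI := T.instAlgebraFbar
         letI := T.instAlgebraKFbar; letI := T.instIsElliptic
         ¬ (∀ p ∈ T.I.supportPrimes, ∀ v w : placesOver (fieldOfModuli T.E) p,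
            (Summit.ABC.IUTFork.DHData.ofInput T.I).logQloc p v = (Summit.ABC.IUTFork.DHData.ofInput T.I).logQloc p w)) →
        T.HullEstimateOf
          (((l : ℝ) + 1) / 4 *
            ((1 + 12 * (Cor22.dmod P : ℝ) / l) * (P.logDiff + Cor22.logCondAvoid P {2, l})
              + 2 * Real.log l + 52
              + 20 / 3 * Real.log (((2 ^ 12 * 3 ^ 3 * 5 * Cor22.dmod P : ℕ) : ℝ) * (l : ℝ))
                * (Nat.primeCounting (2 ^ 12 * 3 ^ 3 * 5 * Cor22.dmod P * l) : ℝ))))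
    : _root_.ABC := by
  refine abc_of_SH_v11M_window M archPk archSub Ψ act Mmod region frobAdm frobLogvol frobΨ frobMmod unitImage ballImage thetaDiv n lat sig
    split qData qK (fun P hP l hl h5 hc h2 h5' h6 T hnd => ?_) (fun P hP l hl h5 hc h2 h5' h6 T hd => ?_) hreg
  · -- window side: `¬DeepM(T)` from `¬DeepOrdM(T)`
    letI := T.instFieldF; letI := T.instNumberFieldF; letI := T.instAlgebraF; letI := T.instFieldK
    letI := T.instNumberFieldK; letI := T.instAlgebraK; letI := T.instFieldFbar; letI := T.instAlgebraFbar
    letI := T.instAlgebraKFbar; letI := T.instIsElliptic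
    exact hSHw P hP l hl h5 hc h2 h5' h6 T
      (fun hd => hnd ((GenuineMShrink2.deepM_iff_deepOrdM T.D (ideleDataOf T.D T.isVolumeInputOf)).mpr hd))
  · -- deep side: `DeepOrdM(T)` from `DeepM(T)`
    letI := T.instFieldF; letI := T.instNumberFieldF; letI := T.instAlgebraF; letI := T.instFieldK
    letI := T.instNumberFieldK; letI := T.instAlgebraK; letI := T.instFieldFbar; letI := T.instAlgebraFbar
    letI := T.instAlgebraKFbar; letI := T.instIsElliptic
    exact hNum P hP l hl h5 hc h2 h5' h6 T ((GenuineMShrink2.deepM_iff_deepOrdM T.D (ideleDataOf T.D T.isVolumeInputOf)).mp hd)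

end Summit.ABC.IUTFork.Conditional

end
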